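import Literature.Topology.FourManifolds.TautFoliations
import Mathlib.Topology.Separation.Connected
import Mathlib.Analysis.SpecialFunctions.Trigonometric.Deriv
import Mathlib.Analysis.Calculus.Deriv.MeanValue
import HarnessLib

/-!
# The product foliation of `S² × S¹` by spheres

Companion of `TautFoliations.lean` (definitions `Literature.Topology.FourManifolds.Foliation`, `IsTransverselyOriented`,
`IsClosedTransversal`, `IsTaut`, `HasCompactLeafOfGenus`, and the use of Novikov's theorem on
`S² × S¹` — every compact leaf of a transversely oriented taut foliation of `S² × S¹` has genus
`0` — as the spelled-out hypothesis of `Literature.Topology.FourManifolds.Knot.genus_eq_zero_of_isIntegralSurgery_zero_of_novikov`,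
proved modulo Novikov's `π₁`-injectivity theorem in `TautFoliationsNovikovProofs.lean`). This file
constructs, with complete proofs, the model object of that theorem and thereby checks that the
definitions express it and that its hypotheses are jointly satisfiable:

* `Literature.Topology.FourManifolds.Foliation.northChart`, `Literature.Topology.FourManifolds.Foliation.southChart` (**definitions**): the two *oriented*
  stereographic charts of the circle `𝕊 1 ⊆ 𝔼 2`, `x ↦ -2x₀/(1 - x₁)` off the north pole
  `N = (0, 1)` and `x ↦ 2x₀/(1 + x₁)` off the south pole, both onto `ℝ`, with
  `northChart x * southChart x = -4` on the overlap (`northChart_mul_southChart`), so that the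
  change of charts `t ↦ -4/t` is increasing (`circleCharts_locally_increasing`).
* `Literature.Topology.FourManifolds.Foliation.productSpheres` (**definition**): the product foliation of `↥(𝕊 2) × ↥(𝕊 1)`
  by the spheres `𝕊 2 × {θ}`, as a `C⁰` foliated atlas with flow boxes
  `(stereographic' 2 p).prod c`, `c ∈ {northChart, southChart}`.
* `isTransverselyOriented_productSpheres`, `leaf_productSpheres` (the leaves are the spheres
  `𝕊 2 × {θ}`), `hasCompactLeafOfGenus_zero_productSpheres`, `isClosedTransversal_circleLoop`
  (`{q} × S¹`, parametrised by `s ↦ (q, loopPt s)` with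
  `loopPt s = circlePoint (π/2 - 2πs) = (sin 2πs, cos 2πs)` through the tree's `Literature.Topology.FourManifolds.circlePoint`,
  is a closed transversal: its heights `-2 cot(πs)`, `2 tan(πs)` in the two circle charts are
  strictly increasing), `isTaut_productSpheres` (**proved**), summarised in
  `Literature.Topology.FourManifolds.Foliation.productSpheres_isTransverselyOriented_isTaut_hasCompactLeafOfGenus_zero`.

## References

* G. Hector, U. Hirsch, *Introduction to the Geometry of Foliations, Part A* (1986), Ch. II
  2.1.2 (ii) (product foliations), 2.2.9 (iii) (closed transversals) [HectorHirsch1986].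
* D. Gabai, *Foliations and the topology of 3-manifolds*, J. Differential Geom. 18 (1983),
  Thm. 2.8 (3) ("`S² × S¹` with the product foliation") [Gabai1983].

## Design notes

* The circle is `𝕊 1 = Metric.sphere (0 : 𝔼 2) 1` (as in all sibling files), not `Circle` or
  `AddCircle`; its two charts are written in the coordinates `x₀, x₁` with explicit rational
  inverses `u ↦ (∓4u/(u²+4), ±(u²-4)/(u²+4))`, so that all chart identities are polynomial
  identities modulo `x₀² + x₁² = 1` (`linear_combination`). Mathlib's `stereographic'` is not
  used for the circle factor because its identification `(ℝ ∙ v)ᗮ ≃ 𝔼 1` is a chosen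
  orthonormal basis of unspecified orientation.
* Notation `𝔼 n`, `𝕊 n` is local, as in the sibling files.
-/

open scoped Manifold ContDiff Topology
open Function Set

noncomputable section

namespace Literature.Topology.FourManifolds

/-- Local notation: `𝔼 n` is the model Euclidean space `EuclideanSpace ℝ (Fin n)`. -/
local notation "𝔼 " n:arg => EuclideanSpace ℝ (Fin n)

/-- Local notation: `𝕊 n` is the unit sphere in `EuclideanSpace ℝ (Fin (n + 1))`, the standard
`n`-sphere with its Mathlib manifold structure. -/
local notation "𝕊 " n:arg => (Metric.sphere (0 : EuclideanSpace ℝ (Fin (n + 1))) 1)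

namespace Foliation

/-! ## Two oriented charts of the circle -/

/-- A point of `𝕊 1 ⊆ 𝔼 2` has `x₀² + x₁² = 1`. [folklore] -/
theorem sphereOne_sq_add_sq (x : 𝕊 1) : (x : 𝔼 2) 0 ^ 2 + (x : 𝔼 2) 1 ^ 2 = 1 := by
  have h : ‖(x : 𝔼 2)‖ = 1 := by simp
  have h2 : ‖(x : 𝔼 2)‖ ^ 2 = (x : 𝔼 2) 0 ^ 2 + (x : 𝔼 2) 1 ^ 2 := by
    rw [EuclideanSpace.norm_eq, Real.sq_sqrt (by positivity), Fin.sum_univ_two]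
    simp [sq_abs]
  rw [← h2, h, one_pow]

/-- `‖(a, b)‖² = a² + b²` in `𝔼 2`. [folklore] -/
theorem norm_mkTwo_sq (a b : ℝ) : ‖(!₂[a, b] : 𝔼 2)‖ ^ 2 = a ^ 2 + b ^ 2 := by
  rw [EuclideanSpace.norm_eq, Real.sq_sqrt (by positivity), Fin.sum_univ_two]
  simp [sq_abs]

/-- First coordinate identity behind `northChart.left_inv`: a polynomial identity modulo
`a² + b² = 1`. [folklore] -/
theorem northChart_leftInv_zero (a b : ℝ) (h : a ^ 2 + b ^ 2 = 1) (hb : 1 - b ≠ 0) :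
    -(4 * (-2 * a / (1 - b))) / ((-2 * a / (1 - b)) ^ 2 + 4) = a := by
  have h4 : (-2 * a / (1 - b)) ^ 2 + 4 ≠ 0 := by positivity
  field_simp
  linear_combination (-4 * a) * h

/-- Second coordinate identity behind `northChart.left_inv`. [folklore] -/
theorem northChart_leftInv_one (a b : ℝ) (h : a ^ 2 + b ^ 2 = 1) (hb : 1 - b ≠ 0) :
    ((-2 * a / (1 - b)) ^ 2 - 4) / ((-2 * a / (1 - b)) ^ 2 + 4) = b := by
  have h4 : (-2 * a / (1 - b)) ^ 2 + 4 ≠ 0 := by positivity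
  field_simp
  linear_combination (4 * (1 - b)) * h

/-- The inverse of the north-pole chart: `u ↦ (-4u/(u²+4), (u²-4)/(u²+4))`. [folklore] -/
def northChartInv (u : ℝ) : 𝕊 1 :=
  ⟨!₂[-(4 * u) / (u ^ 2 + 4), (u ^ 2 - 4) / (u ^ 2 + 4)], by
    have hu : u ^ 2 + 4 ≠ 0 := by positivity
    have h : ‖(!₂[-(4 * u) / (u ^ 2 + 4), (u ^ 2 - 4) / (u ^ 2 + 4)] : 𝔼 2)‖ ^ 2 = 1 := by
      rw [norm_mkTwo_sq]
      field_simp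
      ring
    rw [mem_sphere_zero_iff_norm]
    nlinarith [norm_nonneg (!₂[-(4 * u) / (u ^ 2 + 4), (u ^ 2 - 4) / (u ^ 2 + 4)] : 𝔼 2)]⟩

/-- First coordinate of `northChartInv`. [folklore] -/
@[simp] theorem northChartInv_apply_zero (u : ℝ) :
    (northChartInv u : 𝔼 2) 0 = -(4 * u) / (u ^ 2 + 4) := by simp [northChartInv]

/-- Second coordinate of `northChartInv`. [folklore] -/
@[simp] theorem northChartInv_apply_one (u : ℝ) :
    (northChartInv u : 𝔼 2) 1 = (u ^ 2 - 4) / (u ^ 2 + 4) := by simp [northChartInv]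

/-- `northChartInv` is continuous. [folklore] -/
theorem continuous_northChartInv : Continuous northChartInv :=
  Continuous.subtype_mk (by fun_prop (disch := intros; positivity)) _

/-- The coordinate functions of `𝕊 1` are continuous. [folklore] -/
theorem continuous_apply_sphereOne (i : Fin 2) : Continuous fun x : 𝕊 1 ↦ (x : 𝔼 2) i :=
  (EuclideanSpace.proj i).continuous.comp continuous_subtype_val

/-- The **oriented stereographic chart of `𝕊 1` from the north pole** `N = (0, 1)`:
`x ↦ -2x₀/(1 - x₁)` on `𝕊 1 ∖ {N}`, a homeomorphism onto `ℝ` with inverse `northChartInv`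
(in the parametrisation `(sin θ, cos θ)` it is `-2 cot(θ/2)`, increasing in `θ ∈ (0, 2π)`).
[folklore] -/
def northChart : OpenPartialHomeomorph (𝕊 1) ℝ where
  toFun x := -2 * (x : 𝔼 2) 0 / (1 - (x : 𝔼 2) 1)
  invFun := northChartInv
  source := {x | (x : 𝔼 2) 1 ≠ 1}
  target := univ
  map_source' _ _ := trivial
  map_target' u _ := by
    simp only [mem_setOf_eq, northChartInv_apply_one]
    have hu : u ^ 2 + 4 ≠ 0 := by positivity
    intro h
    rw [div_eq_one_iff_eq hu] at h
    linarith
  left_inv' x hx := by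
    have hx1 : 1 - (x : 𝔼 2) 1 ≠ 0 := sub_ne_zero.2 (Ne.symm hx)
    have hsq := sphereOne_sq_add_sq x
    apply Subtype.ext
    ext i
    fin_cases i
    · simpa using northChart_leftInv_zero _ _ hsq hx1
    · simpa using northChart_leftInv_one _ _ hsq hx1
  right_inv' u _ := by
    simp only [northChartInv_apply_zero, northChartInv_apply_one]
    have hu : u ^ 2 + 4 ≠ 0 := by positivity
    field_simp
    ring
  open_source := isOpen_ne_fun (continuous_apply_sphereOne 1) continuous_const
  open_target := isOpen_univ
  continuousOn_toFun :=
    ContinuousOn.div (continuous_const.mul (continuous_apply_sphereOne 0)).continuousOn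
      (continuous_const.sub (continuous_apply_sphereOne 1)).continuousOn
      fun _ hx ↦ sub_ne_zero.2 (Ne.symm hx)
  continuousOn_invFun := continuous_northChartInv.continuousOn

/-- Formula for `northChart`. [folklore] -/
@[simp] theorem northChart_apply (x : 𝕊 1) :
    northChart x = -2 * (x : 𝔼 2) 0 / (1 - (x : 𝔼 2) 1) := rfl

/-- The source of `northChart` is the complement of the north pole. [folklore] -/
@[simp] theorem northChart_source : northChart.source = {x : 𝕊 1 | (x : 𝔼 2) 1 ≠ 1} := rfl

/-- `northChart` is onto `ℝ`. [folklore] -/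
@[simp] theorem northChart_target : northChart.target = univ := rfl

/-- The **oriented stereographic chart of `𝕊 1` from the south pole** `S = (0, -1)`:
`x ↦ 2x₀/(1 + x₁)` on `𝕊 1 ∖ {S}`, i.e. `northChart` precomposed with the antipodal map
`Homeomorph.neg (𝕊 1)`. [folklore] -/
def southChart : OpenPartialHomeomorph (𝕊 1) ℝ :=
  (Homeomorph.neg (𝕊 1)).toOpenPartialHomeomorph.trans northChart

/-- Formula for `southChart`: `x ↦ 2x₀/(1 + x₁)`. [folklore] -/
@[simp] theorem southChart_apply (x : 𝕊 1) :
    southChart x = 2 * (x : 𝔼 2) 0 / (1 + (x : 𝔼 2) 1) := by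
  simp [southChart, sub_neg_eq_add]

/-- The source of `southChart` is the complement of the south pole. [folklore] -/
@[simp] theorem southChart_source : southChart.source = {x : 𝕊 1 | (x : 𝔼 2) 1 ≠ -1} := by
  ext x
  simp [southChart, neg_eq_iff_eq_neg]

/-- `southChart` is onto `ℝ`. [folklore] -/
@[simp] theorem southChart_target : southChart.target = univ := by
  simp [southChart]

/-- On the common domain the two charts satisfy `northChart x * southChart x = -4`. [folklore] -/
theorem northChart_mul_southChart (x : 𝕊 1) (hN : (x : 𝔼 2) 1 ≠ 1) (hS : (x : 𝔼 2) 1 ≠ -1) :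
    northChart x * southChart x = -4 := by
  have h1 : 1 - (x : 𝔼 2) 1 ≠ 0 := sub_ne_zero.2 (Ne.symm hN)
  have h2 : 1 + (x : 𝔼 2) 1 ≠ 0 := by
    intro h; exact hS (by linarith)
  have hsq := sphereOne_sq_add_sq x
  rw [northChart_apply, southChart_apply]
  field_simp
  linear_combination (-4 : ℝ) * hsq


/-- `-4/a < -4/b` for `a < b` of the same sign. [folklore] -/
theorem neg_four_div_lt {a b : ℝ} (hab : 0 < a * b) (h : a < b) : -4 / a < -4 / b := by
  have ha : a ≠ 0 := fun h0 ↦ by simp [h0] at hab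
  have hb : b ≠ 0 := fun h0 ↦ by simp [h0] at hab
  have : -4 / a - -4 / b = 4 * (a - b) / (a * b) := by
    field_simp
    ring
  rw [← sub_neg, this]
  exact div_neg_of_neg_of_pos (by linarith) hab

/-- The two oriented circle charts `{northChart, southChart}`. [folklore] -/
def circleCharts : Set (OpenPartialHomeomorph (𝕊 1) ℝ) := {northChart, southChart}

/-- Both circle charts are onto `ℝ`. [folklore] -/
theorem target_eq_of_mem_circleCharts {c : OpenPartialHomeomorph (𝕊 1) ℝ}
    (hc : c ∈ circleCharts) : c.target = univ := by
  rcases hc with rfl | rfl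
  · rfl
  · exact southChart_target

/-- The two circle charts cover `𝕊 1`. [folklore] -/
theorem exists_mem_circleCharts_source (w : 𝕊 1) : ∃ c ∈ circleCharts, w ∈ c.source := by
  by_cases h : (w : 𝔼 2) 1 = 1
  · refine ⟨southChart, Or.inr rfl, ?_⟩
    rw [southChart_source]
    simp only [mem_setOf_eq, h]
    norm_num
  · exact ⟨northChart, Or.inl rfl, h⟩

/-- Change of circle charts is increasing near every point of the overlap. [folklore] -/
theorem circleCharts_locally_increasing {c c' : OpenPartialHomeomorph (𝕊 1) ℝ}
    (hc : c ∈ circleCharts) (hc' : c' ∈ circleCharts) {w₀ : 𝕊 1}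
    (hw₀ : w₀ ∈ c.source ∩ c'.source) :
    ∃ V ∈ 𝓝 w₀, ∀ y ∈ V ∩ (c.source ∩ c'.source), ∀ z ∈ V ∩ (c.source ∩ c'.source),
      c y < c z → c' y < c' z := by
  -- same chart: trivial
  by_cases hcc : c = c'
  · subst hcc
    exact ⟨univ, Filter.univ_mem, fun y _ z _ h ↦ h⟩
  -- different charts: {c, c'} = {north, south}; on the overlap north * south = -4 and north ≠ 0
  have key : ∀ w ∈ northChart.source ∩ southChart.source,
      northChart w * southChart w = -4 := fun w hw ↦
    northChart_mul_southChart w (by simpa using hw.1) (by simpa using hw.2)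
  have hov : c.source ∩ c'.source = northChart.source ∩ southChart.source := by
    rcases hc with rfl | rfl <;> rcases hc' with rfl | rfl
    · exact absurd rfl hcc
    · rfl
    · exact Set.inter_comm _ _
    · exact absurd rfl hcc
  -- the sign of `c` is locally constant near w₀ (c w₀ ≠ 0)
  have hc0 : c w₀ ≠ 0 := by
    intro h0
    have := key w₀ (hov ▸ hw₀)
    rcases hc with rfl | rfl
    · rw [h0, zero_mul] at this; norm_num at this
    · rw [h0, mul_zero] at this; norm_num at this
  have hVopen : IsOpen (c.source ∩ c ⁻¹' {t | 0 < t * c w₀}) :=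
    c.continuousOn.isOpen_inter_preimage c.open_source
      (isOpen_lt continuous_const (continuous_id.mul continuous_const))
  refine ⟨c.source ∩ c ⁻¹' {t | 0 < t * c w₀}, hVopen.mem_nhds ⟨hw₀.1, ?_⟩, ?_⟩
  · simpa using mul_self_pos.2 hc0
  intro y hy z hz hyz
  have hy' : 0 < c y * c w₀ := hy.1.2
  have hz' : 0 < c z * c w₀ := hz.1.2
  have hyz' : 0 < c y * c z := by
    have h1 : 0 < (c y * c w₀) * (c z * c w₀) := mul_pos hy' hz'
    have h2 : (c y * c w₀) * (c z * c w₀) = (c y * c z) * (c w₀ * c w₀) := by ring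
    rw [h2] at h1
    exact (mul_pos_iff_of_pos_right (mul_self_pos.2 hc0)).1 h1
  have ey : c' y = -4 / c y := by
    have hy2 : y ∈ northChart.source ∩ southChart.source := hov ▸ hy.2
    have := key y hy2
    have hne : c y ≠ 0 := fun h0 ↦ by simp [h0] at hyz'
    rcases hc with rfl | rfl <;> rcases hc' with rfl | rfl
    · exact absurd rfl hcc
    · field_simp; linarith
    · field_simp; linarith
    · exact absurd rfl hcc
  have ez : c' z = -4 / c z := by
    have hz2 : z ∈ northChart.source ∩ southChart.source := hov ▸ hz.2
    have := key z hz2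
    have hne : c z ≠ 0 := fun h0 ↦ by simp [h0] at hyz'
    rcases hc with rfl | rfl <;> rcases hc' with rfl | rfl
    · exact absurd rfl hcc
    · field_simp; linarith
    · field_simp; linarith
    · exact absurd rfl hcc
  rw [ey, ez]
  exact neg_four_div_lt hyz' hyz


/-! ### The foliated atlas of `S² × S¹` -/

/-- `rank_ℝ 𝔼 (2 + 1) = 2 + 1`, the `Fact` needed by `stereographic' 2`. [folklore] -/
theorem fact_finrank_euclideanSpace_two_add_one :
    Fact (Module.finrank ℝ (𝔼 (2 + 1)) = 2 + 1) :=
  ⟨finrank_euclideanSpace_fin⟩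

attribute [local instance] fact_finrank_euclideanSpace_two_add_one

/-- The **product foliation of `S² × S¹` by the spheres `S² × {θ}`**, as a `C⁰` foliated atlas:
the flow boxes are the products `(stereographic' 2 p).prod c` of a stereographic chart of `𝕊 2`
(onto `𝔼 2`) with one of the two oriented circle charts `c ∈ {northChart, southChart}` (onto
`ℝ`); the height of a point is the circle coordinate, so plaques are the slices
`(𝕊 2 ∖ {p}) × {θ}`. [folklore] -/
def productSpheres : Foliation (𝔼 2) ((𝕊 2) × (𝕊 1)) where
  atlas := {e | ∃ (p : 𝕊 2) (c : OpenPartialHomeomorph (𝕊 1) ℝ), c ∈ circleCharts ∧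
    e = (stereographic' 2 p).prod c}
  target_eq := by
    rintro e ⟨p, c, hc, rfl⟩
    rw [OpenPartialHomeomorph.prod_target, stereographic'_target, target_eq_of_mem_circleCharts hc,
      univ_prod_univ]
  exists_mem_source x := by
    obtain ⟨c, hc, hxc⟩ := exists_mem_circleCharts_source x.2
    refine ⟨(stereographic' 2 (-x.1)).prod c, ⟨-x.1, c, hc, rfl⟩, ?_⟩
    rw [OpenPartialHomeomorph.prod_source, stereographic'_source]
    exact ⟨mem_compl_singleton_iff.2 (ne_neg_of_mem_unit_sphere ℝ x.1), hxc⟩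
  locally_plaque := by
    rintro e ⟨p, c, hc, rfl⟩ e' ⟨p', c', hc', rfl⟩ x -
    refine ⟨univ, Filter.univ_mem, ?_⟩
    rintro y ⟨-, hy, -⟩ z ⟨-, hz, -⟩ h
    rw [OpenPartialHomeomorph.prod_source] at hy hz
    simp only [OpenPartialHomeomorph.prod_apply] at h ⊢
    rw [c.injOn hy.2 hz.2 h]

/-- The height of a point in a flow box of `productSpheres` is its circle coordinate.
[folklore] -/
theorem productSpheres_height {p : 𝕊 2} {c : OpenPartialHomeomorph (𝕊 1) ℝ}
    (y : (𝕊 2) × (𝕊 1)) : ((stereographic' 2 p).prod c y).2 = c y.2 := rfl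

/-- The product foliation of `S² × S¹` is transversely oriented (the change of circle charts is
`t ↦ -4/t`, increasing on each half-line). [folklore] -/
theorem isTransverselyOriented_productSpheres : productSpheres.IsTransverselyOriented := by
  rintro e ⟨p, c, hc, rfl⟩ e' ⟨p', c', hc', rfl⟩ x hx
  rw [OpenPartialHomeomorph.prod_source, OpenPartialHomeomorph.prod_source] at hx
  obtain ⟨V, hV, hmono⟩ := circleCharts_locally_increasing hc hc' (w₀ := x.2) ⟨hx.1.2, hx.2.2⟩
  refine ⟨Prod.snd ⁻¹' V, continuous_snd.continuousAt.preimage_mem_nhds hV, ?_⟩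
  rintro y ⟨hyV, hy⟩ z ⟨hzV, hz⟩ h
  rw [OpenPartialHomeomorph.prod_source, OpenPartialHomeomorph.prod_source] at hy hz
  exact hmono y.2 ⟨hyV, hy.1.2, hy.2.2⟩ z.2 ⟨hzV, hz.1.2, hz.2.2⟩ h

/-- `𝕊 2` has a point different from two given ones (it is infinite, being connected, `T₁` and
nontrivial). [folklore] -/
theorem exists_ne_ne_sphereTwo (a b : 𝕊 2) : ∃ p : 𝕊 2, p ≠ a ∧ p ≠ b := by
  haveI : ConnectedSpace (𝕊 2) := connectedSpace_sphereTwo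
  have hinf : (univ : Set (𝕊 2)).Infinite :=
    IsPreconnected.infinite_of_nontrivial isPreconnected_univ
      ⟨a, trivial, -a, trivial, ne_neg_of_mem_unit_sphere ℝ a⟩
  classical
  obtain ⟨p, -, hp⟩ := hinf.exists_notMem_finset {a, b}
  simp only [Finset.mem_insert, Finset.mem_singleton, not_or] at hp
  exact ⟨p, hp.1, hp.2⟩

/-- The leaves of the product foliation of `S² × S¹` are the spheres `S² × {θ}`. [folklore] -/
theorem leaf_productSpheres (x : (𝕊 2) × (𝕊 1)) :
    productSpheres.leaf x = {y | y.2 = x.2} := by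
  ext y
  simp only [mem_leaf_iff, mem_setOf_eq]
  constructor
  · intro h
    induction h with
    | rel a b hab =>
      obtain ⟨e, ⟨p, c, hc, rfl⟩, ha, hb, h⟩ := hab
      rw [OpenPartialHomeomorph.prod_source] at ha hb
      exact (c.injOn ha.2 hb.2 h).symm
    | refl a => rfl
    | symm a b _ ih => exact ih.symm
    | trans a b c _ _ ih₁ ih₂ => exact ih₂.trans ih₁
  · intro h
    obtain ⟨p, hpx, hpy⟩ := exists_ne_ne_sphereTwo x.1 y.1
    obtain ⟨c, hc, hxc⟩ := exists_mem_circleCharts_source x.2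
    refine Relation.EqvGen.rel x y ⟨(stereographic' 2 p).prod c, ⟨p, c, hc, rfl⟩, ?_, ?_, ?_⟩
    · rw [OpenPartialHomeomorph.prod_source, stereographic'_source]
      exact ⟨fun h' ↦ hpx h'.symm, hxc⟩
    · rw [OpenPartialHomeomorph.prod_source, stereographic'_source]
      exact ⟨fun h' ↦ hpy h'.symm, h ▸ hxc⟩
    · simp only [OpenPartialHomeomorph.prod_apply, h]

/-- Every leaf `S² × {θ}` of the product foliation of `S² × S¹` is a compact leaf of genus `0`.
[folklore] -/
theorem hasCompactLeafOfGenus_zero_productSpheres :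
    productSpheres.HasCompactLeafOfGenus 0 := by
  haveI : ConnectedSpace (𝕊 2) := connectedSpace_sphereTwo
  let x : (𝕊 2) × (𝕊 1) :=
    (⟨EuclideanSpace.single 0 1, by simp⟩, ⟨EuclideanSpace.single 0 1, by simp⟩)
  have hleaf : productSpheres.leaf x = Set.range (fun q : 𝕊 2 ↦ (q, x.2)) := by
    rw [leaf_productSpheres]
    ext y
    simp only [mem_setOf_eq, mem_range]
    constructor
    · intro h
      exact ⟨y.1, Prod.ext rfl h.symm⟩
    · rintro ⟨q, rfl⟩
      rfl
  have hemb : Topology.IsClosedEmbedding (fun q : 𝕊 2 ↦ (q, x.2)) :=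
    (continuous_id.prodMk continuous_const).isClosedEmbedding fun a b h ↦ congrArg Prod.fst h
  let φ : (𝕊 2) ≃ₜ productSpheres.leaf x :=
    hemb.isEmbedding.toHomeomorph.trans (Homeomorph.setCongr hleaf.symm)
  refine HasCompactLeafOfGenus.intro x ?_ (𝕊 2) (isOrientable_sphere_holds 2) ?_ φ
  · rw [hleaf]
    exact isCompact_range hemb.continuous
  · haveI := ModuleCat.subsingleton_of_isZero
      (Literature.AlgebraicTopology.SingularHomology.isZero_singularHomology_sphere_holds ℤ ℤ (n := 2) (k := 1) one_ne_zero (by decide))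
    exact Module.finrank_zero_of_subsingleton


/-! ### The closed transversals `{q} × S¹` and tautness -/

/-- The loop parameter `loopPt s = circlePoint (π/2 - 2πs) = (sin 2πs, cos 2πs)` (so that
`0 ↦ N = (0, 1)`), through the tree's `Literature.circlePoint θ = (cos θ, sin θ)` (`Knots.lean`).
[folklore] -/
def loopPt (s : ℝ) : 𝕊 1 := circlePoint (Real.pi / 2 - 2 * Real.pi * s)

/-- First coordinate of `loopPt`. [folklore] -/
@[simp] theorem loopPt_apply_zero (s : ℝ) :
    (loopPt s : 𝔼 2) 0 = Real.sin (2 * Real.pi * s) := by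
  rw [loopPt, circlePoint_apply_zero, Real.cos_pi_div_two_sub]

/-- Second coordinate of `loopPt`. [folklore] -/
@[simp] theorem loopPt_apply_one (s : ℝ) :
    (loopPt s : 𝔼 2) 1 = Real.cos (2 * Real.pi * s) := by
  rw [loopPt, circlePoint_apply_one, Real.sin_pi_div_two_sub]

/-- `loopPt` is continuous (`continuous_circlePoint`). [folklore] -/
theorem continuous_loopPt : Continuous loopPt :=
  continuous_circlePoint.comp (by fun_prop)

/-- `loopPt` is `1`-periodic (`periodic_circlePoint`). [folklore] -/
theorem loopPt_add_one (s : ℝ) : loopPt (s + 1) = loopPt s := by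
  rw [loopPt, loopPt, show Real.pi / 2 - 2 * Real.pi * (s + 1) =
    Real.pi / 2 - 2 * Real.pi * s - 2 * Real.pi by ring]
  exact periodic_circlePoint.sub_eq _

/-- Every point of `𝕊 1` is `loopPt s` for some `s` (`circlePoint_surjective`). [folklore] -/
theorem exists_loopPt_eq (w : 𝕊 1) : ∃ s, loopPt s = w := by
  obtain ⟨θ, rfl⟩ := circlePoint_surjective w
  refine ⟨(Real.pi / 2 - θ) / (2 * Real.pi), ?_⟩
  rw [loopPt]
  congr 1
  field_simp
  ring

open Real in
/-- The height of `loopPt` in the north chart, `-2 sin(2πr)/(1 - cos(2πr)) = -2 cot(πr)`, is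
strictly increasing on every interval avoiding the north pole. [folklore] -/
theorem strictMonoOn_northChart_loopPt {a b : ℝ} (h : ∀ r ∈ Ioo a b, cos (2 * π * r) ≠ 1) :
    StrictMonoOn (fun r ↦ northChart (loopPt r)) (Ioo a b) := by
  have hf : ∀ r, northChart (loopPt r) = -2 * sin (2 * π * r) / (1 - cos (2 * π * r)) := by
    intro r
    simp
  simp_rw [hf]
  have hder : ∀ r ∈ Ioo a b, HasDerivAt (fun r ↦ -2 * sin (2 * π * r) / (1 - cos (2 * π * r)))
      ((-2 * (cos (2 * π * r) * (2 * π)) * (1 - cos (2 * π * r)) -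
        -2 * sin (2 * π * r) * (0 - -sin (2 * π * r) * (2 * π))) / (1 - cos (2 * π * r)) ^ 2)
      r := by
    intro r hr
    have hc : HasDerivAt (fun r ↦ 2 * π * r) (2 * π) r := by
      simpa using (hasDerivAt_id r).const_mul (2 * π)
    exact ((hc.sin.const_mul (-2)).div ((hasDerivAt_const r 1).sub hc.cos)
      (sub_ne_zero.2 (h r hr).symm))
  refine strictMonoOn_of_deriv_pos (convex_Ioo a b)
    (fun r hr ↦ (hder r hr).continuousAt.continuousWithinAt) ?_
  intro r hr
  rw [interior_Ioo] at hr
  rw [(hder r hr).deriv]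
  have hlt : cos (2 * π * r) < 1 := lt_of_le_of_ne (cos_le_one _) (h r hr)
  have key : (-2 * (cos (2 * π * r) * (2 * π)) * (1 - cos (2 * π * r)) -
      -2 * sin (2 * π * r) * (0 - -sin (2 * π * r) * (2 * π))) =
      4 * π * (1 - cos (2 * π * r)) := by
    linear_combination (4 * π) * sin_sq_add_cos_sq (2 * π * r)
  rw [key]
  apply div_pos
  · have : 0 < 1 - cos (2 * π * r) := sub_pos.2 hlt
    positivity
  · exact pow_pos (sub_pos.2 hlt) 2

open Real in
/-- The height of `loopPt` in the south chart, `2 sin(2πr)/(1 + cos(2πr)) = 2 tan(πr)`, is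
strictly increasing on every interval avoiding the south pole. [folklore] -/
theorem strictMonoOn_southChart_loopPt {a b : ℝ} (h : ∀ r ∈ Ioo a b, cos (2 * π * r) ≠ -1) :
    StrictMonoOn (fun r ↦ southChart (loopPt r)) (Ioo a b) := by
  have hf : ∀ r, southChart (loopPt r) = 2 * sin (2 * π * r) / (1 + cos (2 * π * r)) := by
    intro r
    simp
  simp_rw [hf]
  have hne : ∀ r ∈ Ioo a b, 1 + cos (2 * π * r) ≠ 0 := fun r hr h0 ↦ h r hr (by linarith)
  have hder : ∀ r ∈ Ioo a b, HasDerivAt (fun r ↦ 2 * sin (2 * π * r) / (1 + cos (2 * π * r)))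
      ((2 * (cos (2 * π * r) * (2 * π)) * (1 + cos (2 * π * r)) -
        2 * sin (2 * π * r) * (0 + -sin (2 * π * r) * (2 * π))) / (1 + cos (2 * π * r)) ^ 2)
      r := by
    intro r hr
    have hc : HasDerivAt (fun r ↦ 2 * π * r) (2 * π) r := by
      simpa using (hasDerivAt_id r).const_mul (2 * π)
    exact ((hc.sin.const_mul 2).div ((hasDerivAt_const r 1).add hc.cos) (hne r hr))
  refine strictMonoOn_of_deriv_pos (convex_Ioo a b)
    (fun r hr ↦ (hder r hr).continuousAt.continuousWithinAt) ?_
  intro r hr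
  rw [interior_Ioo] at hr
  rw [(hder r hr).deriv]
  have hlt : -1 < cos (2 * π * r) := lt_of_le_of_ne (neg_one_le_cos _) (fun h' ↦ h r hr h'.symm)
  have key : (2 * (cos (2 * π * r) * (2 * π)) * (1 + cos (2 * π * r)) -
      2 * sin (2 * π * r) * (0 + -sin (2 * π * r) * (2 * π))) =
      4 * π * (1 + cos (2 * π * r)) := by
    linear_combination (4 * π) * sin_sq_add_cos_sq (2 * π * r)
  rw [key]
  have hpos : 0 < 1 + cos (2 * π * r) := by linarith
  apply div_pos
  · positivity
  · exact pow_pos hpos 2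

/-- The loop `s ↦ (q, loopPt s)` around the `S¹` factor. [folklore] -/
def circleLoop (q : 𝕊 2) (s : ℝ) : (𝕊 2) × (𝕊 1) := (q, loopPt s)

open Real in
/-- Points near `s` stay on the same side of a level of `cos (2π ·)`: an explicit `ε`.
[folklore] -/
theorem exists_Ioo_cos_lt {s c : ℝ} (h : cos (2 * π * s) < c) :
    ∃ ε > (0 : ℝ), ∀ r ∈ Ioo (s - ε) (s + ε), cos (2 * π * r) < c := by
  have hev : ∀ᶠ r in 𝓝 s, cos (2 * π * r) < c :=
    (by fun_prop : Continuous fun r ↦ cos (2 * π * r)).continuousAt.eventually_lt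
      continuousAt_const h
  obtain ⟨ε, hε, hball⟩ := Metric.eventually_nhds_iff.1 hev
  refine ⟨ε, hε, fun r hr ↦ hball ?_⟩
  rwa [← Real.ball_eq_Ioo, Metric.mem_ball] at hr

open Real in
/-- Symmetric version of `exists_Ioo_cos_lt`. [folklore] -/
theorem exists_Ioo_lt_cos {s c : ℝ} (h : c < cos (2 * π * s)) :
    ∃ ε > (0 : ℝ), ∀ r ∈ Ioo (s - ε) (s + ε), c < cos (2 * π * r) := by
  have hev : ∀ᶠ r in 𝓝 s, c < cos (2 * π * r) :=
    continuousAt_const.eventually_lt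
      (by fun_prop : Continuous fun r ↦ cos (2 * π * r)).continuousAt h
  obtain ⟨ε, hε, hball⟩ := Metric.eventually_nhds_iff.1 hev
  refine ⟨ε, hε, fun r hr ↦ hball ?_⟩
  rwa [← Real.ball_eq_Ioo, Metric.mem_ball] at hr

open Real in
/-- **`{q} × S¹` is a closed transversal** of the product foliation of `S² × S¹`. [folklore] -/
theorem isClosedTransversal_circleLoop (q : 𝕊 2) :
    productSpheres.IsClosedTransversal (circleLoop q) := by
  refine ⟨continuous_const.prodMk continuous_loopPt, fun s ↦ ?_, fun s ↦ ?_⟩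
  · simp only [circleLoop, loopPt_add_one]
  by_cases hs : cos (2 * π * s) < 1 / 2
  · obtain ⟨ε, hε, hI⟩ := exists_Ioo_cos_lt hs
    have hI' : ∀ r ∈ Ioo (s - ε) (s + ε), cos (2 * π * r) ≠ 1 := fun r hr h1 ↦ by
      have := hI r hr; rw [h1] at this; norm_num at this
    refine ⟨(stereographic' 2 (-q)).prod northChart, ⟨-q, northChart, Or.inl rfl, rfl⟩, ε, hε,
      fun r hr ↦ ?_, Or.inl (strictMonoOn_northChart_loopPt hI')⟩
    rw [OpenPartialHomeomorph.prod_source, stereographic'_source]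
    refine ⟨mem_compl_singleton_iff.2 (ne_neg_of_mem_unit_sphere ℝ q), ?_⟩
    show ((loopPt r : 𝕊 1) : 𝔼 2) 1 ≠ 1
    rw [loopPt_apply_one]
    exact hI' r hr
  · have hs' : (1 / 2 : ℝ) ≤ cos (2 * π * s) := not_lt.1 hs
    obtain ⟨ε, hε, hI⟩ := exists_Ioo_lt_cos (show -(1 / 2 : ℝ) < cos (2 * π * s) by linarith)
    have hI' : ∀ r ∈ Ioo (s - ε) (s + ε), cos (2 * π * r) ≠ -1 := fun r hr h1 ↦ by
      have := hI r hr; rw [h1] at this; norm_num at this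
    refine ⟨(stereographic' 2 (-q)).prod southChart, ⟨-q, southChart, Or.inr rfl, rfl⟩, ε, hε,
      fun r hr ↦ ?_, Or.inl (strictMonoOn_southChart_loopPt hI')⟩
    rw [OpenPartialHomeomorph.prod_source, stereographic'_source, southChart_source]
    refine ⟨mem_compl_singleton_iff.2 (ne_neg_of_mem_unit_sphere ℝ q), ?_⟩
    show ((loopPt r : 𝕊 1) : 𝔼 2) 1 ≠ -1
    rw [loopPt_apply_one]
    exact hI' r hr

/-- **The product foliation of `S² × S¹` is taut**: the leaf through `x` meets the closed
transversal `{x.1} × S¹` (at `x` itself). [folklore] -/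
theorem isTaut_productSpheres : productSpheres.IsTaut := fun x ↦ by
  obtain ⟨s, hs⟩ := exists_loopPt_eq x.2
  refine ⟨circleLoop x.1, isClosedTransversal_circleLoop x.1, s, ?_⟩
  rw [circleLoop, hs]
  exact productSpheres.mem_leaf_self x

/-- **The model of Novikov's theorem on `S² × S¹`**: the product foliation by spheres is a
transversely oriented taut `C⁰` foliation of `S² × S¹` with a compact leaf of genus `0` — so
the hypotheses of Novikov's theorem on `S² × S¹` (the hypothesis `hN` of
`Knot.genus_eq_zero_of_isIntegralSurgery_zero_of_novikov`, the conclusion of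
`Foliation.genus_eq_zero_of_isTaut_sphereTwo_prod_sphereOne_of_novikov`) are jointly satisfiable,
by the foliation that theorem says is the only one (Gabai (1983), Thm. 2.8 (3)). [folklore] -/
theorem productSpheres_isTransverselyOriented_isTaut_hasCompactLeafOfGenus_zero :
    productSpheres.IsTransverselyOriented ∧ productSpheres.IsTaut ∧
      productSpheres.HasCompactLeafOfGenus 0 :=
  ⟨isTransverselyOriented_productSpheres, isTaut_productSpheres,
    hasCompactLeafOfGenus_zero_productSpheres⟩

end Foliation

end Literature.Topology.FourManifolds
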